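/-
Copyright (c) 2026 the pub-hodgecm-mathlib formalisation cell (harness21).  Prover seat hodgecm-mathlib-K2E3-p12 (g8), Track B ∕ K2-LIT, h413 = `stmt-HodgeConjecture-24833`,
line `K2_E1_TraceFormulaBeta`, 5Res ROADCARD «ENDGAME BY FAMILIES» (K2E1-plan (g7), (154)∕(260)): the LETTER-FREE DISCHARGE of the Gram letters `hOD` (★ p860123
`K2E1ChiSectionPlancherelKTypeCMTwo`) and `hXF` (ibid. `isOrtho_chiSection_families_cm_two`) by ★ C1∕H-b `K2E1ChiPseudoEisensteinInnerProductCMTwo` — the off-dual family `Θ_χ` IS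
isometric to the Mellin ⊗ section model, and non-associate families ARE orthogonal, with no hypothesis left but the data (`χ` unitary, off-dual ∕ non-associate).
-/
import Summits.HodgeConjecture.HodgeConjecture.Theorems.K2E1ChiPseudoEisensteinInnerProductCMTwo   -- ★ H-b p860712 (this seat): (XF) `…_eq_zero_cm_two`, (OD) `…_offDual_cm_two`
import Summits.HodgeConjecture.HodgeConjecture.Theorems.K2E1ChiSectionPlancherelKTypeCMTwo        -- ★ p860123 (K2E1-p12): the `hOD`∕`hXF` letters, `hOD_axis_of_line`, the isometry engine
import HarnessLib

/-!
# (260) — `K2E1ChiSectionPlancherelGramDischargeCMTwo`: `hOD` AND `hXF` PAID — the off-dual Plancherel isometry `Θ_χ ≅ L²(ℝ) ⊗̂ V(χ)` and the cross-family orthogonality `Θ_χ ⟂ Θ_{χ′}`, LETTER-FREE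

Track B ∕ K2-LIT, crux h413 = `stmt-HodgeConjecture-24833`, route of record `HCCMUnconditional`; cell `hodgecm-mathlib`, squad K2, ENGINE E1.  THEOREMS ONLY (no `def`, no `instance`,
no `notation`, no named-fact hypothesis, no `sorry`); lane `--supports stmt-HodgeConjecture-24833 --as helper` (count-neutral).
THE MATHEMATICS (ROADCARD (154) §1 (OD)∕(XF); [MoeglinWaldspurger1995, II.2.1, II.2.4]; [TateThesis1967, Thm. 4.4.1]).  ★ p860123 proved, ON THE LETTER `hOD` (the one-term inner product
formula in axis currency), that the closed span `Θ_χ` of the twisted pseudo-Eisenstein classes `[θ_{f_i,φ_i}]` is ISOMETRIC to the model `L²(ℝ × K_U)` via `[θ_{f,φ}] ↦ √(C∕2π)·f̃(−(½+iy))φ(k)`,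
and, ON THE LETTER `hXF`, that two families pairing to zero have orthogonal closed spans.  ★ H-b pays both letters: (OD) `chiPseudoEisenstein_inner_product_offDual_cm_two` gives `hOD` in
`σ₀`-line currency for every UNITARY `χ` whose family is not self-associate (`χ(χʷ)⁻¹` not a norm twist) — converted to the axis by ★ `hOD_axis_of_line` (★ A Parseval I twice) — and (XF)
`chiPseudoEisenstein_inner_product_eq_zero_cm_two` gives `hXF` for UNITARY `χ, χ′` with `χ′χ⁻¹`, `χ′(χʷ)⁻¹` not norm twists.  Hence, with NO letter: (§1) one constant `C > 0` and the axis
Gram identity for every off-dual family; the representatives-and-isometry package of ★ `exists_repr_and_linearIsometry_chiSection_offDual_cm_two`; (§2) `closure span[θ_{f_i,φ_i}] ⟂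
closure span[θ_{f′_j,φ′_j}]` for non-associate unitary `χ, χ′`.  (The self-dual letter `hSD` of ★ `K2E1ChiSectionPlancherelSelfDualCMTwo` :184 is in VECTOR-GRAM currency `⟪v_b, M z v_a⟫`;
★ H-c (SD) delivers the section-valued pairing `(ν𝓕)⁻¹∫_{K_U} φ_a·conj I_{φ_b}(z̄,·)` — its packaging as an operator `M z` on `span{v_a}` is the (y1-b) desk's currency and is not done here.)
* §1 **`exists_hOD_cm_two`** (the axis Gram identity, letter-free), **`exists_repr_and_linearIsometry_chiSection_offDual_letterFree_cm_two`**.  * §2 **`isOrtho_chiSection_families_letterFree_cm_two`**.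
HONEST LABEL: HC_CM is proved only modulo the 7 printed citations (2 remaining named inputs: hLiu418 = `stmt-HodgeConjecture-24832`, h413 = `stmt-HodgeConjecture-24833`) until rung 0
closes; this file asserts no named fact, closes no socket; count-neutral; letter-free.

## References
* [MoeglinWaldspurger1995] C. Mœglin, J.-L. Waldspurger, *Spectral decomposition and Eisenstein series* (1995), II.2.1, II.2.4.
* [TateThesis1967] J. Tate, *Fourier analysis in number fields and Hecke's zeta-functions*, in Cassels–Fröhlich (1967), Thm. 4.4.1.
* [ReedSimonI1980] M. Reed, B. Simon, *Methods of Modern Mathematical Physics I* (1980), Thm. I.7.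
-/

set_option autoImplicit false
set_option linter.dupNamespace false  -- the mandated namespace repeats the summit's segment (`HodgeConjecture.HodgeConjecture`)

noncomputable section

open MeasureTheory Measure Set Filter Topology Complex NumberField IsDedekindDomain
open scoped Real NNReal ENNReal ComplexConjugate InnerProductSpace
open Literature.NumberTheory Literature.NumberTheory.Automorphic Literature.NumberTheory.Automorphic.UnitaryGroup AdelicGroupData
open Literature.NumberTheory.GaloisRepresentations (HeckeCharacter)
open Summit.HodgeConjecture.HodgeConjecture.Cruxes.H413.K2E1BorelEisensteinU
open Summit.HodgeConjecture.HodgeConjecture.Cruxes.H413.K2E1CharacterEisensteinU2Defs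
open Summit.HodgeConjecture.HodgeConjecture.Cruxes.H413.K2E1ChiPseudoEisensteinInnerProductCMTwo (chiPseudoEisenstein_inner_product_offDual_cm_two chiPseudoEisenstein_inner_product_eq_zero_cm_two)
open Summit.HodgeConjecture.HodgeConjecture.Cruxes.H413.K2E1ChiSectionPlancherelKTypeCMTwo (hOD_axis_of_line exists_repr_and_linearIsometry_chiSection_offDual_cm_two isOrtho_chiSection_families_cm_two)
open Summit.HodgeConjecture.HodgeConjecture.Cruxes.H413.K2E1PlancherelIsometryOfForm (mem_topologicalClosure_span)

namespace Summit.HodgeConjecture.HodgeConjecture.Cruxes.H413.K2E1ChiSectionPlancherelGramDischargeCMTwo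

variable (L : Type) [Field L] [NumberField L] [IsCMField L]
variable [MeasurableSpace (quasiSplit (↥(maximalRealSubfield L)) L (IsCMField.complexConj L) 2).Adelic] [BorelSpace (quasiSplit (↥(maximalRealSubfield L)) L (IsCMField.complexConj L) 2).Adelic]
variable [MeasurableSpace (AdeleRing (𝓞 L) L)ˣ] [BorelSpace (AdeleRing (𝓞 L) L)ˣ]

/-! ## §1 `hOD` PAID: the axis Gram identity and the off-dual Plancherel isometry, letter-free -/

/-- **`hOD` LETTER-FREE (axis currency).**  Data: an automorphic `μ`, Haar `ν_G` (inversion-invariant), `μ_K`, `ν_I` + idele class domain, `ν` + compact-closure fundamental domain `𝓕` of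
`N(L⁺)` with `ν𝓕 ≠ 0` (as in ★ W-b).  THEN one `C > 0` serves every UNITARY off-dual `χ` (`χ(χʷ)⁻¹` not a norm twist) and every family `(f_i, φ_i)_i` of `C²_c((0,∞))`-profiles and continuous
bounded `χ`-sections: **`∫_X θ_i·conj θ_j dμ = C·((2π)⁻¹∫_ℝ f̃_i(−(½+iy))·conj f̃_j(−(½+iy)) dy)·∫_{K_U} φ_i·conj φ_j dμ_K`** for all `i, j` — ★ H-b (OD) at `σ₀ = 2` ∘ ★ `hOD_axis_of_line`.
[cite: MoeglinWaldspurger1995, II.2.1] [cite: TateThesis1967, Thm. 4.4.1 (Lemma B)] -/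
theorem exists_hOD_cm_two
    (μ : Measure (quasiSplit (↥(maximalRealSubfield L)) L (IsCMField.complexConj L) 2).automorphicQuotient) [(quasiSplit (↥(maximalRealSubfield L)) L (IsCMField.complexConj L) 2).IsAutomorphicMeasure μ]
    (νG : Measure (quasiSplit (↥(maximalRealSubfield L)) L (IsCMField.complexConj L) 2).Adelic) [νG.IsHaarMeasure] [νG.IsInvInvariant]
    (μK : Measure ((standardMaximalCompactGL 2 L).comap (adelicVal (↥(maximalRealSubfield L)) L (IsCMField.complexConj L) 2 ((StdForm.antidiagonal 2).over L)) : Subgroup (quasiSplit (↥(maximalRealSubfield L)) L (IsCMField.complexConj L) 2).Adelic)) [μK.IsHaarMeasure]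
    (νI : Measure (AdeleRing (𝓞 L) L)ˣ) [νI.IsHaarMeasure]
    {𝓕I : Set (AdeleRing (𝓞 L) L)ˣ} (h𝓕I : IsIdeleClassDomain L 𝓕I)
    (ν : Measure ↥(adelicUnipotent (↥(maximalRealSubfield L)) L (IsCMField.complexConj L) 2)) [ν.IsHaarMeasure] {𝓕 : Set ↥(adelicUnipotent (↥(maximalRealSubfield L)) L (IsCMField.complexConj L) 2)}
    (h𝓕N : IsFundamentalDomain ↥(rationalUnipotent (↥(maximalRealSubfield L)) L (IsCMField.complexConj L) 2) 𝓕 ν) (h𝓕c : IsCompact (closure 𝓕)) (h𝓕₀ : ν 𝓕 ≠ 0) :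
    ∃ C : ℝ, 0 < C ∧
      ∀ {ι : Type*} {χ : HeckeCharacter L} {f : ι → ℝ → ℂ} {φ : ι → (quasiSplit (↥(maximalRealSubfield L)) L (IsCMField.complexConj L) 2).Adelic → ℂ}, χ.IsUnitary → ¬ (χ * (reflectChar (IsCMField.complexConj L) χ)⁻¹).IsNormTwist →
        (∀ i, ContDiff ℝ 2 (f i)) → (∀ i, HasCompactSupport (f i)) → (∀ i, tsupport (f i) ⊆ Ioi 0) →
        (∀ i, IsChiSection χ (φ i)) → (∀ i, Continuous (φ i)) → (∀ i, ∃ Cφ : ℝ, ∀ x, ‖φ i x‖ ≤ Cφ) →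
        ∀ i j, ∫ a, (quasiSplit (↥(maximalRealSubfield L)) L (IsCMField.complexConj L) 2).quotFun (eisensteinSeriesU (fun g : (quasiSplit (↥(maximalRealSubfield L)) L (IsCMField.complexConj L) 2).Adelic => f i (borelHeight g : ℝ) * φ i g)) a * conj ((quasiSplit (↥(maximalRealSubfield L)) L (IsCMField.complexConj L) 2).quotFun (eisensteinSeriesU (fun g : (quasiSplit (↥(maximalRealSubfield L)) L (IsCMField.complexConj L) 2).Adelic => f j (borelHeight g : ℝ) * φ j g)) a) ∂μ =
          (C : ℂ) * (((((2 * π)⁻¹ : ℝ) : ℂ) * ∫ y : ℝ, mellin (f i) (-((((1 / 2 : ℝ)) : ℂ) + y * I)) * conj (mellin (f j) (-((((1 / 2 : ℝ)) : ℂ) + y * I)))) * ∫ k, φ i (k : (quasiSplit (↥(maximalRealSubfield L)) L (IsCMField.complexConj L) 2).Adelic) * conj (φ j (k : (quasiSplit (↥(maximalRealSubfield L)) L (IsCMField.complexConj L) 2).Adelic)) ∂μK) := by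
  obtain ⟨C, hC, hOD⟩ := chiPseudoEisenstein_inner_product_offDual_cm_two L μ νG μK νI h𝓕I ν h𝓕N h𝓕c h𝓕₀
  refine ⟨C, hC, ?_⟩
  intro ι χ f φ hχu hoff hf hfs hf0 hφ hφc hφC i j
  refine hOD_axis_of_line L hf hfs hf0 (C := (C : ℂ)) (σ₀ := 2) (fun i j => ?_) i j
  obtain ⟨Ci, hCi⟩ := hφC i
  obtain ⟨Cj, hCj⟩ := hφC j
  exact (hOD hχu hoff (hφ i) (hφc i) hCi (hφ j) (hφc j) hCj (hf i) (hfs i) (hf0 i) (hf j) (hfs j) (hf0 j) one_lt_two).2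

/-- **THE OFF-DUAL PLANCHEREL ISOMETRY, LETTER-FREE (ROADCARD (154) §1 (OD): `Θ_χ ≅ L²(ℝ_{>0}) ⊗̂ V(χ)`, no residual part).**  For every UNITARY off-dual `χ` and every family
`(f_i, φ_i)_i` as above: there are `L²(X,μ)`-representatives `x_i =ᵐ θ_{f_i,φ_i}`, model vectors `u_i =ᵐ f̃_i(−(½+iy))·φ_i(k)` in `L²(ℝ × K_U)`, and a LINEAR ISOMETRY
`U : closure span{x_i} →ₗᵢ L²(ℝ × K_U)` with `U x_i = √(C∕2π)•u_i` and `range U = closure span{√(C∕2π)•u_i}` — ★ `exists_repr_and_linearIsometry_chiSection_offDual_cm_two` fed with §1.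
[cite: MoeglinWaldspurger1995, II.2.1, II.2.4] [cite: ReedSimonI1980, Thm. I.7] -/
theorem exists_repr_and_linearIsometry_chiSection_offDual_letterFree_cm_two
    (μ : Measure (quasiSplit (↥(maximalRealSubfield L)) L (IsCMField.complexConj L) 2).automorphicQuotient) [(quasiSplit (↥(maximalRealSubfield L)) L (IsCMField.complexConj L) 2).IsAutomorphicMeasure μ]
    (νG : Measure (quasiSplit (↥(maximalRealSubfield L)) L (IsCMField.complexConj L) 2).Adelic) [νG.IsHaarMeasure] [νG.IsInvInvariant]
    (μK : Measure ((standardMaximalCompactGL 2 L).comap (adelicVal (↥(maximalRealSubfield L)) L (IsCMField.complexConj L) 2 ((StdForm.antidiagonal 2).over L)) : Subgroup (quasiSplit (↥(maximalRealSubfield L)) L (IsCMField.complexConj L) 2).Adelic)) [μK.IsHaarMeasure]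
    (νI : Measure (AdeleRing (𝓞 L) L)ˣ) [νI.IsHaarMeasure]
    {𝓕I : Set (AdeleRing (𝓞 L) L)ˣ} (h𝓕I : IsIdeleClassDomain L 𝓕I)
    (ν : Measure ↥(adelicUnipotent (↥(maximalRealSubfield L)) L (IsCMField.complexConj L) 2)) [ν.IsHaarMeasure] {𝓕 : Set ↥(adelicUnipotent (↥(maximalRealSubfield L)) L (IsCMField.complexConj L) 2)}
    (h𝓕N : IsFundamentalDomain ↥(rationalUnipotent (↥(maximalRealSubfield L)) L (IsCMField.complexConj L) 2) 𝓕 ν) (h𝓕c : IsCompact (closure 𝓕)) (h𝓕₀ : ν 𝓕 ≠ 0) :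
    ∃ C : ℝ, 0 < C ∧
      ∀ {ι : Type*} {χ : HeckeCharacter L} {f : ι → ℝ → ℂ} {φ : ι → (quasiSplit (↥(maximalRealSubfield L)) L (IsCMField.complexConj L) 2).Adelic → ℂ}, χ.IsUnitary → ¬ (χ * (reflectChar (IsCMField.complexConj L) χ)⁻¹).IsNormTwist →
        (∀ i, ContDiff ℝ 2 (f i)) → (∀ i, HasCompactSupport (f i)) → (∀ i, tsupport (f i) ⊆ Ioi 0) →
        (∀ i, IsChiSection χ (φ i)) → (∀ i, Continuous (φ i)) → (∀ i, ∃ Cφ : ℝ, ∀ x, ‖φ i x‖ ≤ Cφ) →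
      ∃ (x : ι → Lp ℂ 2 μ) (u : ι → Lp ℂ 2 ((volume : Measure ℝ).prod μK)),
        (∀ i, (x i : (quasiSplit (↥(maximalRealSubfield L)) L (IsCMField.complexConj L) 2).automorphicQuotient → ℂ) =ᵐ[μ] (quasiSplit (↥(maximalRealSubfield L)) L (IsCMField.complexConj L) 2).quotFun (eisensteinSeriesU (fun g : (quasiSplit (↥(maximalRealSubfield L)) L (IsCMField.complexConj L) 2).Adelic => f i (borelHeight g : ℝ) * φ i g))) ∧
        (∀ i, (u i : ℝ × ((standardMaximalCompactGL 2 L).comap (adelicVal (↥(maximalRealSubfield L)) L (IsCMField.complexConj L) 2 ((StdForm.antidiagonal 2).over L)) : Subgroup (quasiSplit (↥(maximalRealSubfield L)) L (IsCMField.complexConj L) 2).Adelic) → ℂ) =ᵐ[(volume : Measure ℝ).prod μK] fun p => mellin (f i) (-((((1 / 2 : ℝ)) : ℂ) + p.1 * I)) * φ i (p.2 : (quasiSplit (↥(maximalRealSubfield L)) L (IsCMField.complexConj L) 2).Adelic)) ∧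
        ∃ U : (Submodule.span ℂ (Set.range x)).topologicalClosure →ₗᵢ[ℂ] Lp ℂ 2 ((volume : Measure ℝ).prod μK),
          (∀ i, U ⟨x i, mem_topologicalClosure_span x i⟩ = ((Real.sqrt (C * (2 * π)⁻¹) : ℝ) : ℂ) • u i) ∧
          Set.range U = ((Submodule.span ℂ (Set.range fun i => ((Real.sqrt (C * (2 * π)⁻¹) : ℝ) : ℂ) • u i)).topologicalClosure : Set (Lp ℂ 2 ((volume : Measure ℝ).prod μK))) := by
  haveI := t2Space_adeleRing_of_numberField L
  haveI := locallyCompactSpace_adeleRing' L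
  have hKc : IsCompact ((((standardMaximalCompactGL 2 L).comap (adelicVal (↥(maximalRealSubfield L)) L (IsCMField.complexConj L) 2 ((StdForm.antidiagonal 2).over L)) : Subgroup (quasiSplit (↥(maximalRealSubfield L)) L (IsCMField.complexConj L) 2).Adelic)) : Set (quasiSplit (↥(maximalRealSubfield L)) L (IsCMField.complexConj L) 2).Adelic) := isCompact_comap_adelicVal_standardMaximalCompactGL
  haveI : CompactSpace ((standardMaximalCompactGL 2 L).comap (adelicVal (↥(maximalRealSubfield L)) L (IsCMField.complexConj L) 2 ((StdForm.antidiagonal 2).over L)) : Subgroup (quasiSplit (↥(maximalRealSubfield L)) L (IsCMField.complexConj L) 2).Adelic) := isCompact_iff_compactSpace.1 hKc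
  haveI : IsFiniteMeasure μK := CompactSpace.isFiniteMeasure
  obtain ⟨C, hC, hOD⟩ := exists_hOD_cm_two L μ νG μK νI h𝓕I ν h𝓕N h𝓕c h𝓕₀
  refine ⟨C, hC, ?_⟩
  intro ι χ f φ hχu hoff hf hfs hf0 hφ hφc hφC
  exact exists_repr_and_linearIsometry_chiSection_offDual_cm_two L μ μK hf hfs hf0 hφ hφc hφC hC.le (hOD hχu hoff hf hfs hf0 hφ hφc hφC)

/-! ## §2 `hXF` PAID: non-associate families are orthogonal closed subspaces of `L²(X, μ)` -/

/-- **`Θ_χ ⟂ Θ_{χ′}` LETTER-FREE (ROADCARD (154) §1 (XF)).**  For UNITARY Hecke characters `χ, χ′` with NEITHER `χ′χ⁻¹` NOR `χ′(χʷ)⁻¹` a norm twist, any family of `χ`-data `(f_i, φ_i)`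
and `χ′`-data `(f′_j, φ′_j)` (profiles in `C²_c((0,∞))`, continuous bounded sections), and ANY `L²(X,μ)` representatives `x_i =ᵐ θ_{f_i,φ_i}`, `x′_j =ᵐ θ_{f′_j,φ′_j}`:
**`closure span{x_i} ⟂ closure span{x′_j}`** — ★ H-b (XF) (both character integrals die by Tate's Lemma B ★ GR-χ) fed into ★ `isOrtho_chiSection_families_cm_two`.
[cite: MoeglinWaldspurger1995, II.2.1] [cite: TateThesis1967, Thm. 4.4.1 (Lemma B)] -/
theorem isOrtho_chiSection_families_letterFree_cm_two
    (μ : Measure (quasiSplit (↥(maximalRealSubfield L)) L (IsCMField.complexConj L) 2).automorphicQuotient) [(quasiSplit (↥(maximalRealSubfield L)) L (IsCMField.complexConj L) 2).IsAutomorphicMeasure μ]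
    (νG : Measure (quasiSplit (↥(maximalRealSubfield L)) L (IsCMField.complexConj L) 2).Adelic) [νG.IsHaarMeasure] [νG.IsInvInvariant]
    (μK : Measure ((standardMaximalCompactGL 2 L).comap (adelicVal (↥(maximalRealSubfield L)) L (IsCMField.complexConj L) 2 ((StdForm.antidiagonal 2).over L)) : Subgroup (quasiSplit (↥(maximalRealSubfield L)) L (IsCMField.complexConj L) 2).Adelic)) [μK.IsHaarMeasure]
    (νI : Measure (AdeleRing (𝓞 L) L)ˣ) [νI.IsHaarMeasure]
    {𝓕I : Set (AdeleRing (𝓞 L) L)ˣ} (h𝓕I : IsIdeleClassDomain L 𝓕I)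
    (ν : Measure ↥(adelicUnipotent (↥(maximalRealSubfield L)) L (IsCMField.complexConj L) 2)) [ν.IsHaarMeasure] {𝓕 : Set ↥(adelicUnipotent (↥(maximalRealSubfield L)) L (IsCMField.complexConj L) 2)}
    (h𝓕N : IsFundamentalDomain ↥(rationalUnipotent (↥(maximalRealSubfield L)) L (IsCMField.complexConj L) 2) 𝓕 ν) (h𝓕c : IsCompact (closure 𝓕)) (h𝓕₀ : ν 𝓕 ≠ 0)
    {χ χ' : HeckeCharacter L} (hχu : χ.IsUnitary) (hχ'u : χ'.IsUnitary)
    (h₁ : ¬ (χ' * χ⁻¹).IsNormTwist) (h₂ : ¬ (χ' * (reflectChar (IsCMField.complexConj L) χ)⁻¹).IsNormTwist)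
    {ι ι' : Type*} {f : ι → ℝ → ℂ} {φ : ι → (quasiSplit (↥(maximalRealSubfield L)) L (IsCMField.complexConj L) 2).Adelic → ℂ} {f' : ι' → ℝ → ℂ} {φ' : ι' → (quasiSplit (↥(maximalRealSubfield L)) L (IsCMField.complexConj L) 2).Adelic → ℂ}
    (hf : ∀ i, ContDiff ℝ 2 (f i)) (hfs : ∀ i, HasCompactSupport (f i)) (hf0 : ∀ i, tsupport (f i) ⊆ Ioi 0)
    (hφ : ∀ i, IsChiSection χ (φ i)) (hφc : ∀ i, Continuous (φ i)) (hφC : ∀ i, ∃ Cφ : ℝ, ∀ x, ‖φ i x‖ ≤ Cφ)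
    (hf' : ∀ j, ContDiff ℝ 2 (f' j)) (hf's : ∀ j, HasCompactSupport (f' j)) (hf'0 : ∀ j, tsupport (f' j) ⊆ Ioi 0)
    (hφ' : ∀ j, IsChiSection χ' (φ' j)) (hφ'c : ∀ j, Continuous (φ' j)) (hφ'C : ∀ j, ∃ Cφ : ℝ, ∀ x, ‖φ' j x‖ ≤ Cφ)
    (x : ι → Lp ℂ 2 μ) (hx : ∀ i, (x i : (quasiSplit (↥(maximalRealSubfield L)) L (IsCMField.complexConj L) 2).automorphicQuotient → ℂ) =ᵐ[μ] (quasiSplit (↥(maximalRealSubfield L)) L (IsCMField.complexConj L) 2).quotFun (eisensteinSeriesU (fun g : (quasiSplit (↥(maximalRealSubfield L)) L (IsCMField.complexConj L) 2).Adelic => f i (borelHeight g : ℝ) * φ i g)))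
    (x' : ι' → Lp ℂ 2 μ) (hx' : ∀ j, (x' j : (quasiSplit (↥(maximalRealSubfield L)) L (IsCMField.complexConj L) 2).automorphicQuotient → ℂ) =ᵐ[μ] (quasiSplit (↥(maximalRealSubfield L)) L (IsCMField.complexConj L) 2).quotFun (eisensteinSeriesU (fun g : (quasiSplit (↥(maximalRealSubfield L)) L (IsCMField.complexConj L) 2).Adelic => f' j (borelHeight g : ℝ) * φ' j g))) :
    (Submodule.span ℂ (Set.range x)).topologicalClosure ⟂ (Submodule.span ℂ (Set.range x')).topologicalClosure := by
  refine isOrtho_chiSection_families_cm_two L x hx x' hx' fun i j => ?_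
  obtain ⟨Ci, hCi⟩ := hφC i
  obtain ⟨Cj, hCj⟩ := hφ'C j
  exact (chiPseudoEisenstein_inner_product_eq_zero_cm_two L μ νG μK νI h𝓕I ν h𝓕N h𝓕c h𝓕₀ hχ'u hχu h₁ h₂
    (hφ' j) (hφ'c j) hCj (hφ i) (hφc i) hCi (hf' j) (hf's j) (hf'0 j) (hf i) (hfs i) (hf0 i)).2

end Summit.HodgeConjecture.HodgeConjecture.Cruxes.H413.K2E1ChiSectionPlancherelGramDischargeCMTwo

end
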